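import Summits.QuantumFields.YangMills.Theses.CertificationLength
import Summits.QuantumFields.YangMills.Theses.MirrorModularBoosts

/-!
# `CertifiedHypercubicLimit` (crux stmt-QuantumFields-16191, route CertificationLength) — negative side:
# under (A) the crux implies the sibling weak-coupling existence legs verbatim

Refuter crux-attack record (2026-08-17, vetting sweep).  The crux (L)
`Summit.QuantumFields.YangMills.Theses.CertificationLength.CertifiedHypercubicLimit` reads
`CompleteAnalyticityAtLargeScales → ∀ G compact simple, ∀ r : LatticeRep G, ∃ (n ε ℓ₀ bseq sch S),
admissibility ∧ certificates ∧ a_k = ℓ₀/b_k ∧ torus clauses ∧ sch.HasWeakCouplingLimit ∧ one-field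
gauge ∧ W r sch S`, where `W` is the HypercubicLimit package shared verbatim with routes
PencilRigidity / MirrorModularBoosts / CoincidenceRotationBootstrap.

* `not_certifiedHypercubicLimit_of_not_weakCouplingHypercubicLimit` — given (A), **any kill of
  PencilRigidity's `WeakCouplingHypercubicLimit` (stmt-QuantumFields-16120) kills (L)**: instantiate
  (L) at the faithful representation carried by `IsCompactSimpleLieGroup G` and forget the
  certificate conjuncts.  Read positively: modulo (A), (L) is AT LEAST the weak-coupling existence
  leg of the sibling routes, demanded for EVERY faithful `r` (the summit `YangMills` asks `∃ r`) and
  at the certification spacing — (A) enters (L) only through the admissible `(n, ε)` and the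
  certified sizes, never through the ultraviolet half.
* `not_certifiedHypercubicLimit_of_not_weakCouplingHypercubicLimit_mirrorModular` — the same for
  MirrorModularBoosts' `WeakCouplingHypercubicLimit` (stmt-QuantumFields-16154: PencilRigidity's
  statement without the one-field clause), hence, by the landed
  `HypercubicLimit.Negative.not_weakCouplingHypercubicLimit_of_not_hypercubicLimit`, for the β-free
  record `MirrorModularBoosts.HypercubicLimit` (stmt-QuantumFields-8646) as well.
No converse is available: the summit supplies the package for SOME `r` and no certificates, so a
kill of (L) would NOT refute `YangMills` as typed (contrast `HypercubicLimit.Negative.SummitTie`).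
[folklore]
-/

open Literature.MathematicalPhysics.QuantumLattice Literature.MathematicalPhysics.AQFT
  Literature.MathematicalPhysics.QuantumFieldTheory

namespace Summit.QuantumFields.YangMills.Theorems.CertifiedHypercubicLimit.Negative

open Summit.QuantumFields.YangMills.Theses

/-- **Under (A), a kill of PencilRigidity's weak-coupling existence leg kills the certified one**:
`CompleteAnalyticityAtLargeScales → ¬ PencilRigidity.WeakCouplingHypercubicLimit →
¬ CertificationLength.CertifiedHypercubicLimit` (pick the faithful `r` of `IsCompactSimpleLieGroup G`,
drop admissibility, certificates, `a_k = ℓ₀/b_k` and the torus clauses). [folklore] -/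
theorem not_certifiedHypercubicLimit_of_not_weakCouplingHypercubicLimit
    (hA : CertificationLength.CompleteAnalyticityAtLargeScales)
    (h : ¬ PencilRigidity.WeakCouplingHypercubicLimit) :
    ¬ CertificationLength.CertifiedHypercubicLimit := by
  intro hL
  refine h fun G _ _ _ _ hG => ?_
  letI : MeasurableSpace G := borel G
  haveI : BorelSpace G := ⟨rfl⟩
  obtain ⟨r⟩ := hG.2
  obtain ⟨n, ε, ℓ₀, bseq, sch, S, -, -, -, -, -, -, -, hweak, hzero, hW⟩ := hL hA G hG r
  exact ⟨r, sch, S, hweak, hzero, hW⟩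

/-- **Under (A), a kill of MirrorModularBoosts' weak-coupling existence leg kills the certified
one**: `CompleteAnalyticityAtLargeScales → ¬ MirrorModularBoosts.WeakCouplingHypercubicLimit →
¬ CertificationLength.CertifiedHypercubicLimit` (as above, forgetting the one-field clause too).
[folklore] -/
theorem not_certifiedHypercubicLimit_of_not_weakCouplingHypercubicLimit_mirrorModular
    (hA : CertificationLength.CompleteAnalyticityAtLargeScales)
    (h : ¬ MirrorModularBoosts.WeakCouplingHypercubicLimit) :
    ¬ CertificationLength.CertifiedHypercubicLimit := by
  intro hL
  refine h fun G _ _ _ _ hG => ?_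
  letI : MeasurableSpace G := borel G
  haveI : BorelSpace G := ⟨rfl⟩
  obtain ⟨r⟩ := hG.2
  obtain ⟨n, ε, ℓ₀, bseq, sch, S, -, -, -, -, -, -, -, hweak, -, hW⟩ := hL hA G hG r
  exact ⟨r, sch, S, hweak, hW⟩

end Summit.QuantumFields.YangMills.Theorems.CertifiedHypercubicLimit.Negative
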